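import Summits.NavierStokesRegularity.NavierStokesRegularity.Theses.AxisymmetricExtremality
import Literature.Analysis.FluidPDE.RusinSverakSingularPoint
import Literature.Analysis.FluidPDE.RusinSverakCompactness
import Literature.Analysis.FluidPDE.AxisymmetricTypeIBounded
import Literature.Analysis.FluidPDE.SereginSverakAxisymmetric
import Literature.Analysis.FluidPDE.SelfSimilar

/-!
# Strategist s17-g6 (family `-s`, independent census) — typed switches for the crux
`AxisymmetricExtremality.AxisymmetricKatoGlobal` (item stmt-NavierStokesRegularity-15453)

Scratch file of planner-cstrat-stmt-NavierStokesRegularity-15453-s17-g6-0 (2026-08-28).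
Nothing here is filed; these are the SIGNATURES the census `STRATEGY-CENSUS-s17-g6.md` refers to:

* `NoAxisymMinimalBlowupDatum` (W0) — the strictly weaker statement `closes` actually consumes,
  with `closes_via_W0` (kernel-checked: it suffices verbatim) and `noAxisymMinimal_of_crux`
  (crux ⇒ W0; the converse is NOT available — W0 is a route edit, not a decomposition of the crux).
* `AxisymClaySmooth` (W2) — the smooth finite-energy (Clay-class) axisymmetric statement,
  formally weaker than the crux (`axisymClaySmooth_of_crux` is NOT proved here: it needs the
  Kato ⇒ Clay fact; recorded as a signature only).
* `LocalSwirlBoundToFinalTime` (D1, provable) and `AxisRegularBoundedSwirlLocal` (D2 =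
  Ladyzhenskaya's problem in Seregin's local suitable form) — the best typed split; D2 is the
  whole crux in its standard dress (stronger than the crux), so the split is a relocation.
* `BoundedSwirlAxisymLiouville` (S⁺ candidate) — the KNSS bounded-ancient Liouville statement in
  the axisymmetric class; kills Type I only.
* `AxisTypeIICounterexampleShape` (N) — what a counterexample must look like given the tree.
-/

noncomputable section

open Set MeasureTheory Filter Topology Function Metric
open scoped ENNReal NNReal
open Literature.Analysis.FluidPDE Literature.Analysis.FunctionSpaces

namespace Summit.NavierStokesRegularity.NavierStokesRegularity.Cruxes.AxisymmetricKatoGlobal.StrategistS17g6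

set_option linter.unusedVariables false
set_option linter.dupNamespace false

local notation "ℝ³" => EuclideanSpace ℝ (Fin 3)

open Summit.NavierStokesRegularity.NavierStokesRegularity.Theses.AxisymmetricExtremality

/-! ## W0 — the threshold instance (strictly weaker, suffices verbatim for `closes`) -/

/-- W0: there is no axisymmetric `Ḣ^{1/2}`-minimal (Rusin–Šverák) blow-up datum. -/
def NoAxisymMinimalBlowupDatum : Prop :=
  ∀ ν : ℝ, 0 < ν → ∀ (u₀ : ℝ³ → ℝ³) (g : HomSobolev ℝ³ (EuclideanSpace ℂ (Fin 3)) (1 / 2 : ℝ)),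
    IsMinimalBlowupDatum ν u₀ g → IsAxisymmetric u₀ → False

/-- crux ⇒ W0 (so W0 is weaker; the converse is not available). -/
theorem noAxisymMinimal_of_crux (h : AxisymmetricKatoGlobal) : NoAxisymMinimalBlowupDatum := by
  intro ν hν u₀ g hmin hax
  obtain ⟨hL3, hrep, hdiv, -, hnot⟩ := hmin
  exact hnot (h ν hν u₀ g hL3 hrep hdiv hax)

/-- W0 suffices verbatim for the route's deciding theorem (same proof as `closes`, rev 3). -/
theorem closes_via_W0 (h₂ : MinimalDatumPFold) (h₄ : PFoldToAxisymmetric)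
    (hW : NoAxisymMinimalBlowupDatum) : _root_.NavierStokesRegularity := by
  show Literature.NS.NavierStokesExistenceSmoothR3
  intro ν hν u₀ hsm hdiv hdec
  by_contra hno
  obtain ⟨u₁, g, hmin, hax⟩ := h₄ ν hν (h₂ ν hν ⟨u₀, hsm, hdiv, hdec, hno⟩)
  exact hW ν hν u₁ g hmin hax

/-! ## W2 — the smooth finite-energy (Clay-class) axisymmetric statement -/

/-- W2: Clay (A) restricted to axisymmetric data (Ladyzhenskaya's 1968 problem, classical dress). -/
def AxisymClaySmooth : Prop :=
  ∀ ν : ℝ, 0 < ν → ∀ v₀ : ℝ³ → ℝ³, ContDiff ℝ (⊤ : ℕ∞) v₀ → NSWave0.IsDivFree v₀ →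
    HasRapidSpatialDecay v₀ → IsAxisymmetric v₀ →
    ∃ (u : ℝ → ℝ³ → ℝ³) (p : ℝ → ℝ³ → ℝ), IsSmoothOnHalfSpace u ∧ IsSmoothOnHalfSpace p ∧
      IsNavierStokesSolution ν 0 v₀ u p ∧ HasBoundedEnergy u

/-! ## D1 ∧ D2 — the best typed split (relocation: D2 is the crux in local dress) -/

/-- D1 (provable; size L): local boundedness of the swirl `Γ = r u_θ` up to the final time for an
axisymmetric Kato solution smooth on `(0,T)` — maximum principle for `Γ` on a cylinder
`{r ≤ R, |z| ≤ a} × [t₀, T)` whose parabolic boundary consists of regular points (off-axis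
regularity, landed; caps at heights `±a` chosen off the `P¹`-null axis singular set). -/
def LocalSwirlBoundToFinalTime : Prop :=
  ∀ ν : ℝ, 0 < ν → ∀ T : ℝ, 0 < T → ∀ (u₀ : ℝ³ → ℝ³) (u : ℝ → ℝ³ → ℝ³),
    IsKatoSolutionOn T ν u₀ u → ContDiffOn ℝ (⊤ : ℕ∞) (uncurry u) (Ioo 0 T ×ˢ univ) →
    (∀ t ∈ Ioo 0 T, IsAxisymmetric (u t)) →
    ∀ t₀ ∈ Ioo 0 T, ∀ R : ℝ, 0 < R →
      ∃ M : ℝ, ∀ t ∈ Ico t₀ T, ∀ x : ℝ³, ‖x‖ ≤ R → |swirl (u t) x| ≤ M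

/-- D2 (= Ladyzhenskaya's problem, Seregin's local suitable form; STRONGER than the crux): an
axisymmetric suitable weak solution in the unit space-time cylinder with BOUNDED swirl is regular at
the origin.  Verbatim `stub_sereginLogSwirlOrigin` of `Lines/registered.lean` with the log³ modulus
replaced by a plain bound. -/
def AxisRegularBoundedSwirlLocal : Prop :=
  ∀ (v : ℝ → ℝ³ → ℝ³) (q : ℝ → ℝ³ → ℝ),
    IsSuitableWeakSolutionOn (SereginSverak2009.parCylOpens 0 1) 1 0 v q →
    (∃ C : ℝ≥0, ∀ᵐ t ∂(volume.restrict (Ioo (-1 : ℝ) 0)),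
        ∫⁻ x in SereginSverak2009.spaceCyl 0 1, ‖v t x‖ₑ ^ 2 ≤ C) →
    (∃ G : ℝ → ℝ³ → ℝ³ →L[ℝ] ℝ³,
        HasWeakSpatialGradientOn (SereginSverak2009.parCylOpens 0 1) v G ∧
        ∫⁻ z in SereginSverak2009.parCyl 0 1, ENNReal.ofReal (frobeniusNormSq (G z.1 z.2)) < ∞) →
    (∫⁻ z in SereginSverak2009.parCyl 0 1, ‖q z.1 z.2‖ₑ ^ (3 / 2 : ℝ) < ∞) →
    (∀ t ∈ Ioo (-1 : ℝ) 0, IsAxisymmetric (v t)) →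
    (∀ t ∈ Ioo (-1 : ℝ) 0, IsAxisymmetricScalar (q t)) →
    (∃ C₁ : ℝ, ∀ t ∈ Ioo (-1 : ℝ) 0, ∀ x ∈ SereginSverak2009.spaceCyl 0 1,
        |swirl (v t) x| ≤ C₁) →
    SereginSverak2009.IsRegularAtOrigin v

/-! ## S⁺ — bounded-swirl axisymmetric Liouville (KNSS conjecture, axisymmetric class) -/

/-- S⁺ candidate: a bounded ancient mild solution with axisymmetric slices and bounded swirl is
constant in space at each time (KNSS 2009 conjecture restricted to the axisymmetric class; partial
results KNSS Thm 5.2/5.3, Lei–Zhang–Zhao 2017 (`Γ ∈ L^∞_t L^p_x`, in tree), Lei–Ren–Zhang 2019/21). -/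
def BoundedSwirlAxisymLiouville : Prop :=
  ∀ ν : ℝ, 0 < ν → ∀ u : ℝ → ℝ³ → ℝ³, IsBoundedAncientMildSolution ν u →
    (∀ t < 0, IsAxisymmetric (u t)) →
    (∃ C : ℝ, ∀ t < 0, ∀ x : ℝ³, |swirl (u t) x| ≤ C) →
    ∀ t < 0, ∃ b : ℝ³, ∀ x : ℝ³, u t x = b

/-! ## N — the shape of a counterexample forced by the tree -/

/-- N: the negation of the crux, unfolded to what the landed theorems force: an axisymmetric
weakly divergence-free `L³ ∩ Ḣ^{1/2}` datum whose Kato solution has a singular point ON THE AXIS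
(off-axis regularity), necessarily of Type II (`knss_no_axisymmetric_typeI`), not (discretely)
self-similar.  Only the first two clauses are typed here. -/
def AxisTypeIICounterexampleShape : Prop :=
  ∃ ν : ℝ, 0 < ν ∧ ∃ (u₀ : ℝ³ → ℝ³) (g : HomSobolev ℝ³ (EuclideanSpace ℂ (Fin 3)) (1 / 2 : ℝ)),
    MemLp u₀ 3 volume ∧ g.Represents (Literature.Analysis.FunctionSpaces.EuclideanSpace.complexify ∘ u₀) ∧
    IsWeaklyDivFree u₀ ∧ IsAxisymmetric u₀ ∧ ¬ HasGlobalKatoSolution ν u₀ ∧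
    ∃ T : ℝ, 0 < T ∧ ∃ (xs : ℝ³) (u : ℝ → ℝ³ → ℝ³), IsKatoSolutionOn T ν u₀ u ∧ cylRadius xs = 0 ∧
      ∀ r : ℝ, 0 < r → eLpNorm (uncurry u) ∞ (volume.restrict (parabolicCylinder r (T, xs))) = ∞

/-- The crux is exactly the negation of "some axisymmetric critical datum has no global Kato
solution" (first five clauses of N); trivial bookkeeping. -/
theorem crux_iff_no_counterexample :
    AxisymmetricKatoGlobal ↔
      ¬ ∃ ν : ℝ, 0 < ν ∧ ∃ (u₀ : ℝ³ → ℝ³) (g : HomSobolev ℝ³ (EuclideanSpace ℂ (Fin 3)) (1 / 2 : ℝ)),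
        MemLp u₀ 3 volume ∧ g.Represents (Literature.Analysis.FunctionSpaces.EuclideanSpace.complexify ∘ u₀) ∧
        IsWeaklyDivFree u₀ ∧ IsAxisymmetric u₀ ∧ ¬ HasGlobalKatoSolution ν u₀ := by
  constructor
  · rintro h ⟨ν, hν, u₀, g, hL3, hrep, hdiv, hax, hnot⟩
    exact hnot (h ν hν u₀ g hL3 hrep hdiv hax)
  · intro h ν hν u₀ g hL3 hrep hdiv hax
    by_contra hnot
    exact h ⟨ν, hν, u₀, g, hL3, hrep, hdiv, hax, hnot⟩

end Summit.NavierStokesRegularity.NavierStokesRegularity.Cruxes.AxisymmetricKatoGlobal.StrategistS17g6
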